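import Literature.NumberTheory.EllipticCurves.CuspFormTwistRatPlusSymbol
import Literature.NumberTheory.EllipticCurves.PAdicLFunctionTameBirchTransformProofs
import Literature.NumberTheory.EllipticCurves.QuadraticTwistKroneckerRootNumberProofs
import Literature.NumberTheory.EllipticCurves.PAdicLFunctionNeZeroHoldsProofs
import Literature.NumberTheory.EllipticCurves.ModularityVersionApProofs
import HarnessLib

/-!
# Birch's lemma for the `p`-adic `L`-function of a quadratic twist: `L_p(f_{E^{(d)}}, α', T)` versus the
# `χ_d`-twisted tame transform of `f_E` (Mazur–Tate–Teitelbaum 1986, §I.8; Matsuno 2000, §2), PROOFS ONLY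

A *proofs* file (theorems only: no definition, no named fact, no axiom). Let `E = W/ℚ` be globally minimal,
`d > 0` an odd fundamental discriminant (`d ≡ 1 (mod 4)` squarefree) prime to `N = N_W`, and `A/ℚ` a globally
minimal model of the quadratic twist `W^{(d)}` (`C • W.quadraticTwist d = A`), with newforms `f_W ∈ S₂(Γ₀(N))`,
`f_A ∈ S₂(Γ₀(N_A))` (`IsNewformOf`). Writing `m = |d|` and `χ_d = (· / m)` (Jacobi symbol; a primitive even
quadratic Dirichlet character mod `m`, `exists_dirichletCharacter_eq_jacobiSym`), this file PROVES:

* §1 `exists_mulChar_int_eq_jacobiSym` — `χ_d` as an INTEGER-valued character of `ZMod m` (so that one object is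
  read in `ℤ`, `ℚ`, `ℂ` and `ℚ_p` through `MulChar.ringHomComp`), its evenness / quadraticity, and
  `mulChar_jacobi_complex_isQuadratic_isPrimitive` (its complex avatar is the tree's primitive character).
* §2 `isNewformOf_twist_eq_charTwist` — **the newform of the twist IS Shimura's twisted form**:
  `N_A = N·m²` (`rootNumber_eq_of_cuspCoeff_eq_twist`, from `aₙ(A) = χ_d(n)·aₙ(W)`,
  `LFunction_quadraticTwist_apply_of_int_gcd_eq_one`) and `f_A = charTwist N_A f_W` by the `q`-expansion principle
  (`cuspCoeff_charTwist`, `eq_of_forall_cuspCoeff_eq_gamma0`).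
* §3 `exists_ratPlusSymbol_twist_eq_sum` — **Birch's lemma at the symbol level for the pair `(f_W, f_A)`**:
  ONE rational `c` with `[x]⁺_{f_A} = c · Σ_{b mod m} χ_d(b) · [x + b/m]⁺_{f_W}` for all `x ∈ ℚ` (the tree's
  `exists_rat_forall_ratPlusSymbol_charTwist_eq`, Mazur–Tate–Teitelbaum §I.8, Shimura Prop. 3.64, transported to `f_A`).
* §4 `hasGoodReductionAtPrime_twist_and_frobeniusTrace_eq`, `isOrdinaryAt_twist_and_unitRoot_eq` — at a good
  ordinary prime `p ∤ d` of `W`: `A` is good ordinary at `p`, `a_p(A) = χ_d(p)·a_p(W)` and `α_A = χ_d(p)·α_W`.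
* §5 **`exists_padicLFunction_twist_eq_C_mul_padicLFunctionTame`** — Birch's lemma for the TRANSFORMS:
  `L_p(f_A, α_A, T) = C(c) · (1+T)^{−f_m} · L_p(f_W, m, α_W, χ_d, T)` with `c ≠ 0` (`padicLFunction_twist_eq_of_birch`
  of `PAdicLFunctionTameBirchTransformProofs` fed with §3–§4; `c ≠ 0` by Rohrlich's `L_p(f_A, α_A) ≠ 0`).

The `p = 2` sequel (`PAdicLFunctionQuadraticTwistCongruenceAtTwoProofs`) combines §5 with the tree's
`exists_iwasawa_padicLFunctionTame_congr_two` (Matsuno 2000, Lemmas 3.2–3.3 read at `2`) into the mod-`2` twist congruence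
of the analytic Kida formula. Everything is proved; nothing is asserted. The normalisations are the tree's (`ratPlusSymbol`, `Ω⁺_f`, `padicLFunction`,
`padicLFunctionTame`); the passage to Néron periods (`Ω_W`, `Ω_A`) is NOT made here.

## References

* B. Mazur, J. Tate, J. Teitelbaum, Invent. Math. 84 (1986), §I.8 (twists), §I.10–I.13. [MazurTateTeitelbaum1986Invent]
* K. Matsuno, J. Number Theory 84 (2000) 80–92, §2 (p. 84) and Lemmas 3.2–3.3 (pp. 87–88). [Matsuno2000]
* G. Shimura, *Introduction to the arithmetic theory of automorphic functions* (1971), Prop. 3.64. [Shimura1971]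
* A. O. L. Atkin, J. Lehner, Math. Ann. 185 (1970), §6 (level of the twisted newform). [AtkinLehner1970]
-/

noncomputable section

open scoped MatrixGroups ModularForm NumberTheorySymbols

open CongruenceSubgroup NumberField IsDedekindDomain WeierstrassCurve PowerSeries
  Literature.NumberTheory.EllipticCurves.ModularForms Literature.NumberTheory.EllipticCurves.GreenbergVatsal2000

namespace Literature.NumberTheory.EllipticCurves

/-! ### §1. The Jacobi character `(· / m)` with integer values -/

section JacobiChar

/-- **The Jacobi symbol `(· / m)` as an integer-valued multiplicative character of `ZMod m`** (any `m ≥ 1`;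
`a ↦ (a.val / m)`): multiplicative (`jacobiSym.mul_left`, `jacobiSym.mod_left`), `1 ↦ 1`, and `0` on non-units
(`jacobiSym.eq_zero_iff_not_coprime`). The integer-valued avatar of the tree's complex character
`exists_dirichletCharacter_eq_jacobiSym`. [cite: MontgomeryVaughan2007, §9.3 (quadratic characters, Thm. 9.13)]
[cite: IrelandRosen1990, Prop. 5.2.2] -/
theorem exists_mulChar_int_eq_jacobiSym (m : ℕ) [NeZero m] :
    ∃ χ : MulChar (ZMod m) ℤ, ∀ a : ZMod m, χ a = J((a.val : ℤ) | m) := by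
  let f : ZMod m → ℤ := fun a ↦ J((a.val : ℤ) | m)
  have hf : ∀ a : ZMod m, f a = J((a.val : ℤ) | m) := fun _ ↦ rfl
  have hmul : ∀ a b : ZMod m, f (a * b) = f a * f b := by
    intro a b
    rw [hf, hf, hf, ZMod.val_mul, ← jacobiSym.mul_left]
    refine jacobiSym.mod_left' ?_
    push_cast
    rw [Int.emod_emod_of_dvd _ (dvd_refl _)]
  have hone : f 1 = 1 := by
    rw [hf]
    rcases Nat.lt_or_ge 1 m with h1 | h1
    · haveI : Fact (1 < m) := ⟨h1⟩
      rw [ZMod.val_one, Nat.cast_one, jacobiSym.one_left]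
    · have hm1 : m = 1 := le_antisymm h1 (Nat.pos_of_ne_zero (NeZero.ne m))
      subst hm1
      exact jacobiSym.one_right _
  have hnu : ∀ a : ZMod m, ¬ IsUnit a → f a = 0 := by
    intro a ha
    rw [hf]
    have hval : ¬ IsUnit ((a.val : ℕ) : ZMod m) := by rwa [ZMod.natCast_zmod_val]
    rw [ZMod.isUnit_iff_coprime] at hval
    rw [jacobiSym.eq_zero_iff_not_coprime, Int.gcd_natCast_natCast]
    exact hval
  exact ⟨{ toFun := f, map_one' := hone, map_mul' := hmul, map_nonunit' := hnu }, fun _ ↦ rfl⟩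

variable {m : ℕ} [NeZero m] {χ : MulChar (ZMod m) ℤ} (hχ : ∀ a : ZMod m, χ a = J((a.val : ℤ) | m))
include hχ

/-- Values at integers: `χ(a) = (a / m)` (the symbol is periodic mod `m`). [cite: IrelandRosen1990, Prop. 5.2.2] -/
theorem mulChar_jacobi_apply_intCast (a : ℤ) : χ (a : ZMod m) = J(a | m) := by
  rw [hχ, ZMod.val_intCast, ← jacobiSym.mod_left]

/-- Values at naturals: `χ(n) = (n / m)`. [cite: IrelandRosen1990, Prop. 5.2.2] -/
theorem mulChar_jacobi_apply_natCast (n : ℕ) : χ (n : ZMod m) = J((n : ℤ) | m) := by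
  have h := mulChar_jacobi_apply_intCast hχ (n : ℤ)
  rwa [Int.cast_natCast] at h

/-- The square of a value at a unit is `1` (`jacobiSym.sq_one`: `(a / m) = ±1` for `(a, m) = 1`). [cite: IrelandRosen1990, Prop. 5.2.2] -/
theorem mulChar_jacobi_apply_sq_of_isUnit {a : ZMod m} (ha : IsUnit a) : χ a ^ 2 = 1 := by
  rw [hχ]
  have hval : IsUnit ((a.val : ℕ) : ZMod m) := by rwa [ZMod.natCast_zmod_val]
  rw [ZMod.isUnit_iff_coprime] at hval
  exact jacobiSym.sq_one (by rw [Int.gcd_natCast_natCast]; exact hval)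

/-- The character is quadratic: `χ² = 1` after any change of coefficients. [cite: MontgomeryVaughan2007, §9.3] -/
theorem mulChar_jacobi_ringHomComp_sq {R : Type*} [CommRing R] (φ : ℤ →+* R) : (χ.ringHomComp φ) ^ 2 = 1 := by
  refine MulChar.ext fun a ↦ ?_
  rw [MulChar.pow_apply_coe, MulChar.ringHomComp_apply, ← map_pow, mulChar_jacobi_apply_sq_of_isUnit hχ a.isUnit,
    map_one, MulChar.one_apply_coe]

/-- Evenness for `m ≡ 1 (mod 4)`: `χ(−1) = (−1 / m) = (−1)^{(m−1)/2} = 1` (`jacobiSym.at_neg_one`). [cite: IrelandRosen1990, Prop. 5.2.2] -/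
theorem mulChar_jacobi_apply_neg_one (hm4 : m % 4 = 1) : χ (-1) = 1 := by
  have h := mulChar_jacobi_apply_intCast hχ (-1)
  rw [Int.cast_neg, Int.cast_one] at h
  rw [h, jacobiSym.at_neg_one (Nat.odd_iff.mpr (by omega)), ZMod.χ₄_nat_one_mod_four hm4]

/-- At any `n` coprime to `m`: `χ(n)² = 1` (in particular at a prime `p ∤ m`). [cite: IrelandRosen1990, Prop. 5.2.2] -/
theorem mulChar_jacobi_apply_natCast_sq (n : ℕ) (hn : n.Coprime m) : χ (n : ZMod m) ^ 2 = 1 :=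
  mulChar_jacobi_apply_sq_of_isUnit hχ ((ZMod.isUnit_iff_coprime n m).mpr hn)

/-- **The complex avatar is the tree's primitive quadratic Jacobi character**: for `m` odd squarefree,
`χ.ringHomComp (Int.castRingHom ℂ)` is quadratic and PRIMITIVE of conductor `m`
(`exists_dirichletCharacter_eq_jacobiSym` + extensionality): the Kronecker symbol of the fundamental discriminant `±m`
is a primitive real character mod `m`. [cite: MontgomeryVaughan2007, §9.3 (Thm. 9.13)] -/
theorem mulChar_jacobi_complex_isQuadratic_isPrimitive (hodd : Odd m) (hsq : Squarefree m) :
    (χ.ringHomComp (Int.castRingHom ℂ)).IsQuadratic ∧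
      DirichletCharacter.IsPrimitive (χ.ringHomComp (Int.castRingHom ℂ)) := by
  obtain ⟨χ', hq, hprim, hχ'⟩ := exists_dirichletCharacter_eq_jacobiSym m hodd hsq
  have heq : χ.ringHomComp (Int.castRingHom ℂ) = χ' := by
    refine MulChar.ext fun a ↦ ?_
    rw [MulChar.ringHomComp_apply, hχ, eq_intCast]
    have h := hχ' ((a : ZMod m).val : ℤ)
    rw [Int.cast_natCast, ZMod.natCast_zmod_val] at h
    exact h.symm
  rw [heq]
  exact ⟨hq, hprim⟩

end JacobiChar

/-! ### §2. The newform of the twist is Shimura's twisted form -/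

section Newform

variable (W : WeierstrassCurve ℚ) [W.IsElliptic] {d : ℤ} {A : WeierstrassCurve ℚ} [A.IsElliptic]

omit [A.IsElliptic] in
/-- **`aₙ(A) = χ_d(n)·aₙ(W)`** for a model `A` of `W^{(d)}`, `d ≡ 1 (mod 4)` squarefree prime to `N_W`
(`LFunction_quadraticTwist_apply_of_int_gcd_eq_one`; the `L`-function is an isomorphism invariant, `LFunction_smul`).
[cite: SilvermanAEC2009, X.2 and Exercise 10.16] -/
theorem LFunction_twist_apply (hd4 : d % 4 = 1) (hsq : Squarefree d) (hcop : IsCoprime d (W.conductorNorm ℤ : ℤ))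
    {C : VariableChange ℚ} (hA : C • W.quadraticTwist (d : ℚ) = A) (n : ℕ) :
    A.LFunction n = J((n : ℤ) | d.natAbs) * W.LFunction n := by
  have hd0 : (d : ℚ) ≠ 0 := by exact_mod_cast (show d ≠ 0 by rintro rfl; norm_num at hd4)
  haveI := W.isElliptic_quadraticTwist hd0
  rw [← hA, LFunction_smul]
  exact LFunction_quadraticTwist_apply_of_int_gcd_eq_one W hd4 hsq (Int.isCoprime_iff_gcd_eq_one.mp hcop) n

omit [A.IsElliptic] in
/-- The same in `ℂ` through the Jacobi character `χ` mod `m = |d|`: `aₙ(A) = χ(n)·aₙ(W)`.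
[cite: SilvermanAEC2009, X.2 and Exercise 10.16] -/
theorem LFunction_twist_apply_complex (hd4 : d % 4 = 1) (hsq : Squarefree d)
    (hcop : IsCoprime d (W.conductorNorm ℤ : ℤ)) {C : VariableChange ℚ} (hA : C • W.quadraticTwist (d : ℚ) = A)
    [NeZero d.natAbs] {χ : MulChar (ZMod d.natAbs) ℤ} (hχ : ∀ a : ZMod d.natAbs, χ a = J((a.val : ℤ) | d.natAbs))
    (n : ℕ) : (A.LFunction n : ℂ) = (χ.ringHomComp (Int.castRingHom ℂ)) n * (W.LFunction n : ℂ) := by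
  rw [LFunction_twist_apply W hd4 hsq hcop hA n, Int.cast_mul, MulChar.ringHomComp_apply,
    mulChar_jacobi_apply_natCast hχ, eq_intCast]

/-- **Conductor of the twist: `N_A = N_W · d²`** (Atkin–Lehner 1970 §6; here from the Modularity Theorem through
`rootNumber_eq_of_cuspCoeff_eq_twist`). [cite: AtkinLehner1970, §6] -/
theorem conductorNorm_twist_eq (hmod : exists_isNewformOf) (hd4 : d % 4 = 1) (hsq : Squarefree d)
    (hcop : IsCoprime d (W.conductorNorm ℤ : ℤ)) {C : VariableChange ℚ} (hA : C • W.quadraticTwist (d : ℚ) = A) :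
    A.conductorNorm ℤ = W.conductorNorm ℤ * d.natAbs ^ 2 := by
  have hd0 : d ≠ 0 := by rintro rfl; norm_num at hd4
  haveI : NeZero d.natAbs := ⟨Int.natAbs_ne_zero.mpr hd0⟩
  have hodd : Odd d.natAbs := Int.natAbs_odd.mpr (Int.odd_iff.mpr (by omega))
  have hsq' : Squarefree d.natAbs := Int.squarefree_natAbs.mpr hsq
  obtain ⟨χ, hχ⟩ := exists_mulChar_int_eq_jacobiSym d.natAbs
  obtain ⟨hq, hprim⟩ := mulChar_jacobi_complex_isQuadratic_isPrimitive hχ hodd hsq'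
  have hNm : (W.conductorNorm ℤ).Coprime d.natAbs := by
    have h := Int.isCoprime_iff_gcd_eq_one.mp hcop
    rw [Int.gcd_comm] at h
    unfold Int.gcd at h
    simpa using h
  exact (rootNumber_eq_of_cuspCoeff_eq_twist W hmod hNm hq hprim A
    (fun n ↦ LFunction_twist_apply_complex W hd4 hsq hcop hA hχ n)).2

variable [NeZero (W.conductorNorm ℤ)] [NeZero (A.conductorNorm ℤ)] [NeZero d.natAbs]
  {fW : CuspForm (Gamma0 (W.conductorNorm ℤ)) 2} {fA : CuspForm (Gamma0 (A.conductorNorm ℤ)) 2}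

omit [A.IsElliptic] in
/-- **The newform of the twist is Shimura's twisted form `f_A = (f_W)_χ`** (`charTwist` at level `N_A`, for any
divisibility witnesses `N_W ∣ N_A`, `d² ∣ N_A`): both sides have `q`-expansion `Σ χ_d(n) aₙ(W) qⁿ`
(`cuspCoeff_charTwist`, Shimura 1971 Prop. 3.64; `aₙ(A) = χ_d(n) aₙ(W)`), and a cusp form on `Γ₀(N_A)` is determined
by its `q`-expansion (`eq_of_forall_cuspCoeff_eq_gamma0`). [cite: Shimura1971, Prop. 3.64] -/
theorem isNewformOf_twist_eq_charTwist (hd4 : d % 4 = 1) (hsq : Squarefree d)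
    (hcop : IsCoprime d (W.conductorNorm ℤ : ℤ)) {C : VariableChange ℚ} (hA : C • W.quadraticTwist (d : ℚ) = A)
    (hfW : IsNewformOf W fW) (hfA : IsNewformOf A fA)
    {χ : MulChar (ZMod d.natAbs) ℤ} (hχ : ∀ a : ZMod d.natAbs, χ a = J((a.val : ℤ) | d.natAbs))
    (hq : (χ.ringHomComp (Int.castRingHom ℂ)).IsQuadratic)
    (hprim : DirichletCharacter.IsPrimitive (χ.ringHomComp (Int.castRingHom ℂ)))
    (hN : W.conductorNorm ℤ ∣ A.conductorNorm ℤ) (hm : d.natAbs ^ 2 ∣ A.conductorNorm ℤ) :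
    fA = charTwist (A.conductorNorm ℤ) hN hm hq fW := by
  refine eq_of_forall_cuspCoeff_eq_gamma0 fun n ↦ ?_
  rw [cuspCoeff_charTwist (A.conductorNorm ℤ) hN hm hq hprim fW n, hfA.2 n, hfW.2 n,
    LFunction_twist_apply_complex W hd4 hsq hcop hA hχ n]

end Newform

/-! ### §3. Birch's lemma at the symbol level for the pair `(f_W, f_A)` -/

section Birch

variable (W : WeierstrassCurve ℚ) [W.IsElliptic] {d : ℤ} {A : WeierstrassCurve ℚ} [A.IsElliptic]
  [NeZero (W.conductorNorm ℤ)] [NeZero (A.conductorNorm ℤ)] [NeZero d.natAbs]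
  {fW : CuspForm (Gamma0 (W.conductorNorm ℤ)) 2} {fA : CuspForm (Gamma0 (A.conductorNorm ℤ)) 2}

/-- **Birch's lemma for the newforms of `E` and `E^{(d)}`** (`d > 0`, `d ≡ 1 (mod 4)` squarefree, `(d, N_E) = 1`):
there is ONE rational constant `c` with `[x]⁺_{f_A} = c · Σ_{b mod m} χ_d(b) · [x + b/m]⁺_{f_W}` for every `x ∈ ℚ`
(`m = d`, `χ_d = (· / m)` read in `ℚ`). This is the tree's `exists_rat_forall_ratPlusSymbol_charTwist_eq`
(Mazur–Tate–Teitelbaum §I.8, Shimura Prop. 3.64: `{∞, r}_{f_χ} = g(χ)⁻¹ Σ_u χ(u){∞, r + u/m}_f`, plus parts, `Ω⁺`-normalised)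
transported along `f_A = charTwist N_A f_W` (§2); `χ_d` is even because `d > 0`. [cite: MazurTateTeitelbaum1986Invent, §I.8]
[cite: Shimura1971, Prop. 3.64] -/
theorem exists_ratPlusSymbol_twist_eq_sum (hmod : exists_isNewformOf) (hd : 0 < d) (hd4 : d % 4 = 1)
    (hsq : Squarefree d) (hcop : IsCoprime d (W.conductorNorm ℤ : ℤ)) {C : VariableChange ℚ}
    (hA : C • W.quadraticTwist (d : ℚ) = A) (hfW : IsNewformOf W fW) (hfA : IsNewformOf A fA)
    {χ : MulChar (ZMod d.natAbs) ℤ} (hχ : ∀ a : ZMod d.natAbs, χ a = J((a.val : ℤ) | d.natAbs)) :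
    ∃ c : ℚ, ∀ x : ℚ, ratPlusSymbol fA x =
      c * ∑ b : ZMod d.natAbs, (χ.ringHomComp (Int.castRingHom ℚ)) b * ratPlusSymbol fW (x + (b.val : ℚ) / d.natAbs) := by
  have hmd : (d.natAbs : ℤ) = d := Int.natAbs_of_nonneg hd.le
  have hodd : Odd d.natAbs := Int.natAbs_odd.mpr (Int.odd_iff.mpr (by omega))
  have hsq' : Squarefree d.natAbs := Int.squarefree_natAbs.mpr hsq
  have hm4 : d.natAbs % 4 = 1 := by omega
  obtain ⟨hq, hprim⟩ := mulChar_jacobi_complex_isQuadratic_isPrimitive hχ hodd hsq'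
  have heven : DirichletCharacter.Even (χ.ringHomComp (Int.castRingHom ℂ)) := by
    show (χ.ringHomComp (Int.castRingHom ℂ)) (-1) = 1
    rw [MulChar.ringHomComp_apply, mulChar_jacobi_apply_neg_one hχ hm4, map_one]
  have hNA := conductorNorm_twist_eq W hmod hd4 hsq hcop hA
  have hN : W.conductorNorm ℤ ∣ A.conductorNorm ℤ := ⟨d.natAbs ^ 2, hNA⟩
  have hm : d.natAbs ^ 2 ∣ A.conductorNorm ℤ := ⟨W.conductorNorm ℤ, by rw [hNA, mul_comm]⟩
  have hFA := isNewformOf_twist_eq_charTwist W hd4 hsq hcop hA hfW hfA hχ hq hprim hN hm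
  subst hFA
  obtain ⟨c, hc, -⟩ := exists_rat_forall_ratPlusSymbol_charTwist_eq (A.conductorNorm ℤ) hN hm hq heven hprim
    hfW.1 hfW.coeffField_eq_bot hfA.1 hfA.coeffField_eq_bot (fun u ↦ J((u.val : ℤ) | d.natAbs))
    (fun u ↦ by rw [MulChar.ringHomComp_apply, hχ, eq_intCast])
  refine ⟨c, fun x ↦ ?_⟩
  rw [hc x]
  congr 1
  refine Finset.sum_congr rfl fun b _ ↦ ?_
  rw [MulChar.ringHomComp_apply, hχ, eq_intCast]
  rfl

end Birch

/-! ### §4. Good ordinary reduction and the unit root of the twist -/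

section UnitRoot

variable (W : WeierstrassCurve ℚ) [W.IsElliptic] [W.IsGloballyMinimal] {d : ℤ} {A : WeierstrassCurve ℚ}
  [A.IsElliptic] [A.IsGloballyMinimal] (p : ℕ) [Fact p.Prime]

/-- **`A = E^{(d)}` has good reduction at every good prime `p ∤ d` of `E`, and `a_p(A) = (p / |d|)·a_p(E)`**
(`d ≡ 1 (mod 4)` squarefree prime to `N_E`, so `N_A = N_E d²` is prime to `p`; `a_p = p`-th Dirichlet coefficient at a
good prime, `LFunction_apply_prime_eq_frobeniusTrace`). [cite: SilvermanAEC2009, X.2 and Exercise 10.16] -/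
theorem hasGoodReductionAtPrime_twist_and_frobeniusTrace_eq (hmod : exists_isNewformOf) (hd4 : d % 4 = 1)
    (hsq : Squarefree d) (hcop : IsCoprime d (W.conductorNorm ℤ : ℤ)) {C : VariableChange ℚ}
    (hA : C • W.quadraticTwist (d : ℚ) = A) (hgood : W.HasGoodReductionAtPrime p) (hpd : ¬ (p : ℤ) ∣ d) :
    A.HasGoodReductionAtPrime p ∧ A.frobeniusTrace p = J((p : ℤ) | d.natAbs) * W.frobeniusTrace p := by
  have hp : p.Prime := Fact.out
  have hNA := conductorNorm_twist_eq W hmod hd4 hsq hcop hA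
  have hpN : ¬ p ∣ W.conductorNorm ℤ := fun h ↦ (W.dvd_conductorNorm_iff_not_hasGoodReductionAtPrime p).mp h hgood
  have hpm : ¬ p ∣ d.natAbs := fun h ↦ hpd (Int.natCast_dvd.mpr h)
  have hpNA : ¬ p ∣ A.conductorNorm ℤ := by
    rw [hNA]
    intro h
    rcases (Nat.Prime.dvd_mul hp).mp h with h | h
    · exact hpN h
    · exact hpm (hp.dvd_of_dvd_pow h)
  have hgoodA : A.HasGoodReductionAtPrime p := by
    by_contra h
    exact hpNA ((A.dvd_conductorNorm_iff_not_hasGoodReductionAtPrime p).mpr h)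
  refine ⟨hgoodA, ?_⟩
  have h := LFunction_twist_apply W hd4 hsq hcop hA p
  rwa [LFunction_apply_prime_eq_frobeniusTrace A p hgoodA, LFunction_apply_prime_eq_frobeniusTrace W p hgood] at h

/-- **The twist is good ORDINARY at `p`, with unit root `α_A = (p / |d|)·α_W`**: `a_p(A) = ±a_p(E)` is prime to `p`,
and `±α_W` is a unit root of `X² − a_p(A)X + p`, hence THE unit root (`existsUnique_unitRoot`, Hensel;
Mazur–Tate–Teitelbaum §I.11). [cite: MazurTateTeitelbaum1986Invent, §I.11 (allowable root)] -/
theorem isOrdinaryAt_twist_and_unitRoot_eq (hmod : exists_isNewformOf) (hd4 : d % 4 = 1) (hsq : Squarefree d)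
    (hcop : IsCoprime d (W.conductorNorm ℤ : ℤ)) {C : VariableChange ℚ} (hA : C • W.quadraticTwist (d : ℚ) = A)
    (hord : IsOrdinaryAt W p) (hpd : ¬ (p : ℤ) ∣ d) :
    IsOrdinaryAt A p ∧ unitRoot A p = (J((p : ℤ) | d.natAbs) : ℤ_[p]) * unitRoot W p := by
  have hp : p.Prime := Fact.out
  obtain ⟨hgoodA, haA⟩ := hasGoodReductionAtPrime_twist_and_frobeniusTrace_eq W p hmod hd4 hsq hcop hA hord.1 hpd
  set s : ℤ := J((p : ℤ) | d.natAbs) with hs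
  have hpm : ¬ p ∣ d.natAbs := fun h ↦ hpd (Int.natCast_dvd.mpr h)
  have hs2 : s ^ 2 = 1 :=
    jacobiSym.sq_one (by rw [Int.gcd_natCast_natCast]; exact (Nat.Prime.coprime_iff_not_dvd hp).mpr hpm)
  have hordA : IsOrdinaryAt A p := by
    refine ⟨hgoodA, fun h ↦ hord.2 ?_⟩
    rw [haA] at h
    have h' := h.mul_left s
    rwa [← mul_assoc, ← sq, hs2, one_mul] at h'
  refine ⟨hordA, ?_⟩
  have hEU := existsUnique_unitRoot A p hordA
  have hspecA := unitRoot_spec_holds A p hordA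
  have hspecW := unitRoot_spec_holds W p hord
  have hs2' : (s : ℤ_[p]) ^ 2 = 1 := by exact_mod_cast hs2
  have hβ : ((s : ℤ_[p]) * unitRoot W p) ^ 2 - (A.frobeniusTrace p : ℤ_[p]) * ((s : ℤ_[p]) * unitRoot W p) + p = 0 ∧
      IsUnit ((s : ℤ_[p]) * unitRoot W p) := by
    refine ⟨?_, ?_⟩
    · rw [haA]
      push_cast
      linear_combination (unitRoot W p ^ 2 - (W.frobeniusTrace p : ℤ_[p]) * unitRoot W p) * hs2' + hspecW.1
    · exact (isUnit_iff_exists_inv.mpr ⟨(s : ℤ_[p]), by rw [← sq, hs2']⟩).mul hspecW.2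
  exact hEU.unique hspecA hβ

end UnitRoot

/-! ### §5. Birch's lemma for the transforms: `L_p(f_A, α_A) = C(c)·(1+T)^{−f_m}·L_p(f_W, m, α_W, χ_d)` -/

section Transform

variable (W : WeierstrassCurve ℚ) [W.IsElliptic] [W.IsGloballyMinimal] {d : ℤ} {A : WeierstrassCurve ℚ}
  [A.IsElliptic] [A.IsGloballyMinimal] {p : ℕ} [Fact p.Prime]
  [NeZero (W.conductorNorm ℤ)] [NeZero (A.conductorNorm ℤ)] [NeZero d.natAbs]
  {fW : CuspForm (Gamma0 (W.conductorNorm ℤ)) 2} {fA : CuspForm (Gamma0 (A.conductorNorm ℤ)) 2}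

/-- **Birch's lemma for the `p`-adic `L`-function of the quadratic twist** (`p` a good ordinary prime of `E`, `p ∤ d`;
`d > 0`, `d ≡ 1 (mod 4)` squarefree, `(d, N_E) = 1`; `m = d`, `χ_d = (· / m)`): for some `c ∈ ℚˣ`,
`L_p(f_A, α_A, T) = C(c) · (1+T)^{−f_m} · L_p(f_W, m, α_W, χ_d, T)` in `ℚ_p⟦T⟧`, where the right-hand side is the
Mellin–Mazur transform of the `χ_d`-weighted Mazur–Swinnerton-Dyer measure of `f_W` at tame level `m`
(`padicLFunctionTame`) and `f_m = frobeniusExponent p m` (`m ≡ ω(m)γ^{f_m}`). The tree's `padicLFunction_twist_eq_of_birch`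
(P4c) fed with §3 (symbol relation) and §4 (`α_A = χ_d(p)α_W`); `c ≠ 0` because `L_p(f_A, α_A) ≠ 0` (Rohrlich,
`padicLFunction_unitRoot_ne_zero`). [cite: MazurTateTeitelbaum1986Invent, §I.8 and §I.11–I.13]
[cite: Matsuno2000, §2 (p. 84)] -/
theorem exists_padicLFunction_twist_eq_C_mul_padicLFunctionTame (hmod : exists_isNewformOf) (hd : 0 < d)
    (hd4 : d % 4 = 1) (hsq : Squarefree d) (hcop : IsCoprime d (W.conductorNorm ℤ : ℤ)) {C : VariableChange ℚ}
    (hA : C • W.quadraticTwist (d : ℚ) = A) (hfW : IsNewformOf W fW) (hfA : IsNewformOf A fA)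
    (hord : IsOrdinaryAt W p) (hpd : ¬ (p : ℤ) ∣ d)
    {χ : MulChar (ZMod d.natAbs) ℤ} (hχ : ∀ a : ZMod d.natAbs, χ a = J((a.val : ℤ) | d.natAbs)) :
    ∃ c : ℚ, c ≠ 0 ∧ padicLFunction fA (unitRoot A p : ℚ_[p]) =
      PowerSeries.C (c : ℚ_[p]) * PowerSeries.binomialSeries ℚ_[p] (-frobeniusExponent p (d.natAbs : ℤ_[p])) *
        padicLFunctionTame fW d.natAbs (unitRoot W p : ℚ_[p])
          ((χ.ringHomComp (Int.castRingHom ℚ)).ringHomComp (Rat.castHom ℚ_[p])) := by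
  have hp : p.Prime := Fact.out
  obtain ⟨c, hB⟩ := exists_ratPlusSymbol_twist_eq_sum W hmod hd hd4 hsq hcop hA hfW hfA hχ
  obtain ⟨hordA, hαA⟩ := isOrdinaryAt_twist_and_unitRoot_eq W p hmod hd4 hsq hcop hA hord hpd
  obtain ⟨hαeq, hαu, -⟩ := unitRoot_coe_spec (W := W) hord
  have hpN : ¬ p ∣ W.conductorNorm ℤ := not_dvd_level_of_isNewformOf hfW hord.1
  have hpm : ¬ p ∣ d.natAbs := fun h ↦ hpd (Int.natCast_dvd.mpr h)
  have hmp : d.natAbs.Coprime p := Nat.coprime_comm.mp ((Nat.Prime.coprime_iff_not_dvd hp).mpr hpm)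
  have hap : cuspCoeff fW p = ((W.frobeniusTrace p : ℤ) : ℂ) :=
    cuspCoeff_eq_frobeniusTrace_of_isNewformOf_holds hfW hord.1
  have hχp : (χ.ringHomComp (Int.castRingHom ℚ)) (p : ZMod d.natAbs) ^ 2 = 1 := by
    rw [MulChar.ringHomComp_apply, ← map_pow, mulChar_jacobi_apply_natCast_sq hχ p hmp.symm, map_one]
  have key := padicLFunction_twist_eq_of_birch fW fA hfW.1 hfW.coeffField_eq_bot hpN hmp hap hαeq hαu
    (χ.ringHomComp (Int.castRingHom ℚ)) hχp hB
  have hαA' : (unitRoot A p : ℚ_[p]) =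
      (((χ.ringHomComp (Int.castRingHom ℚ)) (p : ZMod d.natAbs) : ℚ) : ℚ_[p]) * (unitRoot W p : ℚ_[p]) := by
    rw [hαA, MulChar.ringHomComp_apply, mulChar_jacobi_apply_natCast hχ p, eq_intCast]
    push_cast
    rfl
  refine ⟨c, ?_, by rw [hαA']; exact key⟩
  rintro rfl
  have h0 := padicLFunction_unitRoot_ne_zero hordA hfA
  rw [hαA', key, Rat.cast_zero, map_zero, zero_mul, zero_mul] at h0
  exact h0 rfl

end Transform

end Literature.NumberTheory.EllipticCurves

end
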